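import Summits.CriticalPhenomena.Ising3DConformalLimit.Theses.PrecisionLaplacian
import Summits.CriticalPhenomena.Ising3DConformalLimit.Theses.BernsteinTemperature
import Summits.CriticalPhenomena.Ising3DConformalLimit.Theorems.MoebiusLimitOfTwoPointLaw.Negative.TranslationFree
import Summits.CriticalPhenomena.Ising3DConformalLimit.Theorems.PrecisionLaplacianMoebiusLimitOfTwoPointLawInversionBegetsRotations
import HarnessLib

/-!
# Crux `MoebiusLimitOfTwoPointLaw` (item stmt-CriticalPhenomena-4801): the irreducible content is EXISTENCE +
# UNIT-INVERSION covariance — `O(3)` is output (line `two-shell-exchange-markov`, lead, third sharpening)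

The crux disprover's kernel-checked bottom line (`Negative.moebiusLimitOfTwoPointLaw_iff_even_sharper`,
`Negative/TranslationFree.lean`) was: the crux holds iff for every witness `(Δ, c)` of the two-point law there is a
family `T` whose even arities `n ≥ 4` are (a) the locally uniform canonical limits of
`δ^{-nΔ}⟨σ_{[x₁/δ]}⋯σ_{[xₙ/δ]}⟩_{β_c}` off the diagonals, (b) `O(3)` invariant, (c) covariant under the unit inversion
with weight `Δ`.

With the group lemma of this line LANDED (`stub_inversionBegetsRotations`, = item 4675
`PositivityBegetsConformality.InversionBegetsRotations`: translation invariance + unit-inversion covariance ⇒ `O(3)`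
invariance, for every family and every `Δ`) and translations FREE for canonical limits
(`Negative.translationInvariant_of_limit`), obligation (b) DISAPPEARS:

* `moebiusLimitOfTwoPointLaw_iff_existence_and_inversion` — **the crux ⇔ for every `(Δ, c)` witnessing item 0634
  there is `T` with (a) and (c) for the even arities `n ≥ 4`.** Nothing about rotations, translations, dilations or
  the arities `≤ 3` remains to be proved.

Proof of `←`: truncate `T` off `NonCoincident` and set it to `0` in the other arities; the resulting family is
translation invariant (free on `NonCoincident`, trivial off it) and unit-inversion covariant (hypothesis on
`NonCoincident`, which `ι` preserves; trivial off it), hence `O(3)` invariant by the group lemma; feed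
`moebiusLimitOfTwoPointLaw_iff_even_sharper`.
References: crux workfile `Cruxes/MoebiusLimitOfTwoPointLaw/Disproof.lean` §1d/§1e, §5; Di Francesco–Mathieu–Sénéchal
1997 §4.1 (the Möbius group is generated by translations, rotations, dilations and the inversion; here rotations are
generated from translations and the inversion) [FrancescoMathieuSenechal1997].
-/

noncomputable section

namespace Summit.CriticalPhenomena.Ising3DConformalLimit.PrecisionLaplacianMoebiusLimitOfTwoPointLaw

open Literature.Probability.LatticeModels Filter Topology EuclideanGeometry
open Summit.CriticalPhenomena.Ising3DConformalLimit.Theses.PrecisionLaplacian (MoebiusLimitOfTwoPointLaw)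
open Summit.CriticalPhenomena.Ising3DConformalLimit.Theorems.MoebiusLimitOfTwoPointLaw.Negative
  (truncate truncate_of_mem truncate_of_not_mem translationInvariant_of_limit criticalCorr_shift
   moebiusLimitOfTwoPointLaw_iff_even_sharper)

/-- Translations preserve (non-)coincidence. -/
theorem add_mem_nonCoincident_iff {n : ℕ} (v : EuclideanSpace ℝ (Fin 3)) (x : Fin n → EuclideanSpace ℝ (Fin 3)) :
    (fun i => x i + v) ∈ NonCoincident 3 n ↔ x ∈ NonCoincident 3 n := by
  rw [mem_nonCoincident, mem_nonCoincident]
  constructor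
  · exact fun h i i' hii' => h (by simp [hii'])
  · exact fun h i i' hii' => h (add_right_cancel hii')

/-- The unit inversion preserves (non-)coincidence. -/
theorem inversion_mem_nonCoincident_iff {n : ℕ} (x : Fin n → EuclideanSpace ℝ (Fin 3)) :
    (fun i => inversion 0 1 (x i)) ∈ NonCoincident 3 n ↔ x ∈ NonCoincident 3 n := by
  rw [mem_nonCoincident, mem_nonCoincident]
  constructor
  · exact fun h i i' hii' => h (by simp [hii'])
  · exact fun h i i' hii' => h (inversion_injective (0 : EuclideanSpace ℝ (Fin 3)) one_ne_zero hii')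

/-- The regularised family (truncation of `T` off `NonCoincident` in the even arities `≥ 4`, zero elsewhere) is
translation invariant as soon as the even arities `≥ 4` of `T` are canonical limits
(translations are free on `NonCoincident`; off it and in the other arities both sides vanish). -/
theorem isTranslationInvariant_evenTruncate {Δ : ℝ} {T : CorrFamily 3}
    (hT : ∀ n, 4 ≤ n → Even n → TendstoLocallyUniformlyOn
      (rescaledCorrelator (criticalCorr 3) (fun δ => δ ^ (-Δ)) n) (T n) (𝓝[>] (0 : ℝ)) (NonCoincident 3 n)) :
    IsTranslationInvariant (fun n x => if 4 ≤ n ∧ Even n then truncate T n x else 0) := by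
  intro n v x
  by_cases hn : 4 ≤ n ∧ Even n
  · simp only [if_pos hn]
    by_cases hx : x ∈ NonCoincident 3 n
    · have hxv : (fun i => x i + v) ∈ NonCoincident 3 n := (add_mem_nonCoincident_iff v x).2 hx
      rw [truncate_of_mem T hxv, truncate_of_mem T hx]
      exact translationInvariant_of_limit (fun n k y => criticalCorr_shift n k y) _
        (fun y hy => (hT n hn.1 hn.2).tendsto_at hy) v hx
    · have hxv : (fun i => x i + v) ∉ NonCoincident 3 n := fun h => hx ((add_mem_nonCoincident_iff v x).1 h)
      rw [truncate_of_not_mem T hxv, truncate_of_not_mem T hx]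
  · simp only [if_neg hn]

/-- The regularised family is unit-inversion covariant with weight `Δ` as soon as the even arities `≥ 4` of `T` are,
off the origin. -/
theorem isInversionCovariant_evenTruncate {Δ : ℝ} {T : CorrFamily 3}
    (hi : ∀ n, 4 ≤ n → Even n → ∀ x : Fin n → EuclideanSpace ℝ (Fin 3), (∀ i, x i ≠ 0) →
      T n (fun i => inversion 0 1 (x i)) = (∏ i, ‖x i‖ ^ (2 * Δ)) * T n x) :
    IsInversionCovariant Δ (fun n x => if 4 ≤ n ∧ Even n then truncate T n x else 0) := by
  intro n x h0
  by_cases hn : 4 ≤ n ∧ Even n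
  · simp only [if_pos hn]
    by_cases hx : x ∈ NonCoincident 3 n
    · rw [truncate_of_mem T ((inversion_mem_nonCoincident_iff x).2 hx), truncate_of_mem T hx]
      exact hi n hn.1 hn.2 x h0
    · have hIx : (fun i => inversion 0 1 (x i)) ∉ NonCoincident 3 n :=
        fun h => hx ((inversion_mem_nonCoincident_iff x).1 h)
      rw [truncate_of_not_mem T hIx, truncate_of_not_mem T hx, mul_zero]
  · simp only [if_neg hn, mul_zero]

/-- **The crux ⇔ existence + unit-inversion covariance of the even canonical limits.** `MoebiusLimitOfTwoPointLaw`
holds iff for every witness `(Δ, c)` of item 0634 there is a family `T` such that for every EVEN `n ≥ 4`: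
(a) `δ^{-nΔ}⟨σ_{[x₁/δ]}⋯σ_{[xₙ/δ]}⟩_{β_c} → T_n` locally uniformly off the diagonals as `δ → 0⁺`, and
(c) `T_n (ι x) = (∏ᵢ ‖xᵢ‖^{2Δ}) T_n x` off the origin. `O(3)` invariance (obligation (b) of
`Negative.moebiusLimitOfTwoPointLaw_iff_even_sharper`) is OUTPUT: translations are free for canonical limits and
translations + unit inversion generate the rotations (`stub_inversionBegetsRotations`). -/
theorem moebiusLimitOfTwoPointLaw_iff_existence_and_inversion :
    MoebiusLimitOfTwoPointLaw ↔
      ∀ Δ c : ℝ, 0 < c →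
        Tendsto (fun x : Site 3 =>
          criticalTwoPoint 3 x * Real.sqrt (∑ i, ((x i : ℝ)) ^ 2) ^ (2 * Δ)) cofinite (nhds c) →
        ∃ T : CorrFamily 3,
          (∀ n, 4 ≤ n → Even n → TendstoLocallyUniformlyOn
            (rescaledCorrelator (criticalCorr 3) (fun δ => δ ^ (-Δ)) n) (T n) (𝓝[>] (0 : ℝ))
            (NonCoincident 3 n)) ∧
          (∀ n, 4 ≤ n → Even n → ∀ x : Fin n → EuclideanSpace ℝ (Fin 3), (∀ i, x i ≠ 0) →
            T n (fun i => inversion 0 1 (x i)) = (∏ i, ‖x i‖ ^ (2 * Δ)) * T n x) := by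
  rw [moebiusLimitOfTwoPointLaw_iff_even_sharper]
  constructor
  · intro h Δ c hc hP
    obtain ⟨T, hT, -, hi⟩ := h Δ c hc hP
    exact ⟨T, hT, hi⟩
  · intro h Δ c hc hP
    obtain ⟨T, hT, hi⟩ := h Δ c hc hP
    -- the regularised family: truncated off `NonCoincident`, zero in the other arities
    have htr := isTranslationInvariant_evenTruncate hT
    have hinv := isInversionCovariant_evenTruncate hi
    -- O(3) is output: translations + unit inversion generate the rotations (item 4675, landed)
    have hrot : IsRotationInvariant (fun n x => if 4 ≤ n ∧ Even n then truncate T n x else 0) :=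
      stub_inversionBegetsRotations Δ _ htr hinv
    refine ⟨fun n x => if 4 ≤ n ∧ Even n then truncate T n x else 0, ?_, ?_, ?_⟩
    · intro n h4 he
      refine (hT n h4 he).congr_right fun x hx => ?_
      show T n x = if 4 ≤ n ∧ Even n then truncate T n x else 0
      rw [if_pos ⟨h4, he⟩, truncate_of_mem T hx]
    · intro n _ _ R x
      exact hrot n R x
    · intro n _ _ x h0
      exact hinv n x h0

/-- The same reduction under the second host route's spelling of the crux (`Theses.BernsteinTemperature`,
identical definiens). -/
theorem moebiusLimitOfTwoPointLaw_iff_existence_and_inversion' :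
    Theses.BernsteinTemperature.MoebiusLimitOfTwoPointLaw ↔
      ∀ Δ c : ℝ, 0 < c →
        Tendsto (fun x : Site 3 =>
          criticalTwoPoint 3 x * Real.sqrt (∑ i, ((x i : ℝ)) ^ 2) ^ (2 * Δ)) cofinite (nhds c) →
        ∃ T : CorrFamily 3,
          (∀ n, 4 ≤ n → Even n → TendstoLocallyUniformlyOn
            (rescaledCorrelator (criticalCorr 3) (fun δ => δ ^ (-Δ)) n) (T n) (𝓝[>] (0 : ℝ))
            (NonCoincident 3 n)) ∧
          (∀ n, 4 ≤ n → Even n → ∀ x : Fin n → EuclideanSpace ℝ (Fin 3), (∀ i, x i ≠ 0) →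
            T n (fun i => inversion 0 1 (x i)) = (∏ i, ‖x i‖ ^ (2 * Δ)) * T n x) :=
  moebiusLimitOfTwoPointLaw_iff_existence_and_inversion

end Summit.CriticalPhenomena.Ising3DConformalLimit.PrecisionLaplacianMoebiusLimitOfTwoPointLaw

end
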